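import Mathlib.MeasureTheory.Measure.CharacteristicFunction.Basic
import Mathlib.MeasureTheory.Function.AEEqOfLIntegral
import Literature.Analysis.Complex.LaplaceDecaySupport
import HarnessLib

/-!
# Exponential decay of a Laplace transform of a measure forces the density to vanish near `0`

Topic `Literature/Analysis/Complex`. Everything in this file is PROVED (no named facts).

This is the measure version of `Literature.Analysis.Complex.ae_eq_zero_of_laplace_exp_decay`
(file `LaplaceDecaySupport.lean`). Let `m` be a finite positive Borel measure on `ℝ` carried by
`[0, ∞)` (`m (-∞, 0) = 0`), let `S : ℝ → ℂ` be a bounded continuous density, and let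
`G(X) = ∫ e^{-lX} S(l) dm(l)` be the Laplace transform of the complex measure `S dm` along the
real axis. If `‖G(X)‖ ≤ C e^{-κX}` for all large real `X`, with `κ > 0`, then `S = 0` `m`-a.e. on
`(-∞, κ)` (`ae_eq_zero_of_laplace_exp_decay_measure`). As in the function version this is the
one-variable, real-axis form of Pólya's theorem on the indicator of a Laplace–Borel transform
(Boas, *Entire Functions*, §5.3–§5.4: the indicator of `∫ e^{zw} dμ(w)` in the direction `θ` is
the support function of the convex hull of the support of `μ`; here `h(π) = -inf supp (S dm)`).

## Proof

Split `m = m₁ + m₂` with `m₁ = m|_{(-∞,κ)}` (carried by `[0, κ)`) and `m₂ = m|_{[κ,∞)}`. For real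
`X ≥ 0` the piece `m₂` trivially has `‖∫ e^{-lX} S dm₂‖ ≤ e^{-κX} M m(ℝ)`, so the Laplace
transform `G₁` of `S dm₁` is also `O(e^{-κX})`. Now `E(z) = e^{κz} G₁(z)` is entire
(`differentiable_laplace_measure`, differentiation under the integral sign), of exponential type
`κ`, bounded by `M m(ℝ)` on the closed left half-plane (`norm_cexp_mul_laplace_measure_le`) and
bounded on the positive real axis by the decay hypothesis; Phragmén–Lindelöf in the two right
quadrants (`Literature.Analysis.Complex.norm_le_exp_of_re_nonneg`) makes `E` bounded on `ℂ`,
hence constant by Liouville, and the constant is `lim_{X→+∞} E(-X) = 0` by dominated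
convergence (`tendsto_cexp_mul_laplace_measure_atTop`). Thus `G₁ ≡ 0`; on the imaginary axis
this says that the Fourier transform of the finite complex measure `S dm₁` vanishes. Splitting
`S` into real and imaginary parts and each of those into positive and negative parts, the
injectivity of the characteristic function of FINITE POSITIVE measures
(`MeasureTheory.Measure.ext_of_charFun`) gives `(Re S)⁺ dm₁ = (Re S)⁻ dm₁`, hence `Re S = 0`
`m₁`-a.e. (`ae_eq_zero_of_forall_integral_ofReal_mul_cexp_eq_zero`), and likewise for `Im S`
(`ae_eq_zero_of_forall_integral_mul_cexp_eq_zero`).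

## References

* [Boas1954] R. P. Boas, *Entire Functions*, Academic Press 1954, §5.3 (the Borel/Laplace
  transform and the conjugate indicator diagram, Pólya's theorem), §5.4 (properties of the
  indicator).
* G. Doetsch, *Handbuch der Laplace-Transformation*, Band I, Birkhäuser 1950, Kap. 3
  (uniqueness of the Laplace–Stieltjes transform) — secondary.

What is NOT here: the general indicator diagram (all directions `θ`), unbounded densities `S`
(only `S ∈ L^∞ ∩ C` is treated, which is what the users need), and the converse
(support in `[κ, ∞)` ⇒ decay), which is elementary.
-/

noncomputable section

namespace Literature.Analysis.Complex

open _root_.MeasureTheory Set Filter Metric Bornology _root_.Complex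
open scoped Real Topology ComplexConjugate

/-! ### Fourier uniqueness for densities against a finite measure -/

/-- **Fourier uniqueness for a real density against a finite measure.** If `u ∈ L¹(μ)` is real,
`μ` is a finite measure on `ℝ`, and `∫ u(x) e^{iξx} dμ(x) = 0` for every real `ξ`, then `u = 0`
`μ`-a.e. (The finite positive measures `u⁺ μ` and `u⁻ μ` have the same characteristic function,
hence coincide by `MeasureTheory.Measure.ext_of_charFun`.) [folklore] -/
theorem ae_eq_zero_of_forall_integral_ofReal_mul_cexp_eq_zero {μ : Measure ℝ} [IsFiniteMeasure μ]
    {u : ℝ → ℝ} (hu : Integrable u μ)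
    (h : ∀ ξ : ℝ, ∫ x, (u x : ℂ) * cexp (ξ * x * I) ∂μ = 0) : u =ᵐ[μ] 0 := by
  set μp : Measure ℝ := μ.withDensity fun x => ENNReal.ofReal (u x) with hμp
  set μn : Measure ℝ := μ.withDensity fun x => ENNReal.ofReal (-u x) with hμn
  haveI : IsFiniteMeasure μp := isFiniteMeasure_withDensity_ofReal hu.2
  haveI : IsFiniteMeasure μn := isFiniteMeasure_withDensity_ofReal hu.neg.2
  have hum : AEMeasurable (fun x => ENNReal.ofReal (u x)) μ := hu.1.aemeasurable.ennreal_ofReal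
  have humn : AEMeasurable (fun x => ENNReal.ofReal (-u x)) μ :=
    hu.neg.1.aemeasurable.ennreal_ofReal
  have hker : ∀ ξ : ℝ, Continuous fun x : ℝ => cexp (ξ * x * I) := fun ξ => by fun_prop
  have hnorm : ∀ ξ x : ℝ, ‖cexp (ξ * x * I)‖ = 1 := fun ξ x => by
    rw [show (ξ : ℂ) * x * I = ((ξ * x : ℝ) : ℂ) * I by push_cast; ring]
    exact norm_exp_ofReal_mul_I _
  -- integrability of `v • e^{iξx}` for an integrable real `v`
  have hint : ∀ {v : ℝ → ℝ}, Integrable v μ → ∀ ξ : ℝ,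
      Integrable (fun x => v x • cexp (ξ * x * I)) μ := fun hv ξ =>
    hv.smul_bdd 1 (hker ξ).aestronglyMeasurable (Eventually.of_forall fun x => (hnorm ξ x).le)
  have hchar : charFun μp = charFun μn := by
    funext ξ
    rw [charFun_apply_real, charFun_apply_real, hμp, hμn,
      integral_withDensity_eq_integral_toReal_smul₀ hum
        (Eventually.of_forall fun _ => ENNReal.ofReal_lt_top),
      integral_withDensity_eq_integral_toReal_smul₀ humn
        (Eventually.of_forall fun _ => ENNReal.ofReal_lt_top)]
    simp only [ENNReal.toReal_ofReal']
    rw [← sub_eq_zero, ← integral_sub (hint hu.pos_part ξ) (hint hu.neg_part ξ)]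
    have hx : ∀ x : ℝ, max (u x) 0 • cexp (ξ * x * I) - max (-u x) 0 • cexp (ξ * x * I) =
        (u x : ℂ) * cexp (ξ * x * I) := fun x => by
      rw [← sub_smul, max_zero_sub_max_neg_zero_eq_self, real_smul]
    simp_rw [hx]
    exact h ξ
  have heq : μp = μn := Measure.ext_of_charFun hchar
  have hae : (fun x => ENNReal.ofReal (u x)) =ᵐ[μ] fun x => ENNReal.ofReal (-u x) :=
    (withDensity_eq_iff_of_sigmaFinite hum humn).1 heq
  filter_upwards [hae] with x hx
  have h1 := congrArg ENNReal.toReal hx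
  simp only [ENNReal.toReal_ofReal'] at h1
  simp only [Pi.zero_apply]
  rcases le_total 0 (u x) with h0 | h0
  · rwa [max_eq_left h0, max_eq_right (by linarith)] at h1
  · rw [max_eq_right h0, max_eq_left (by linarith)] at h1; linarith

/-- **Fourier uniqueness for a complex density against a finite measure.** If `S ∈ L¹(μ)`,
`μ` is a finite measure on `ℝ`, and `∫ S(x) e^{iξx} dμ(x) = 0` for every real `ξ`, then `S = 0`
`μ`-a.e. (Apply the real version to `Re S = (S + S̄)/2` and `Im S = (S - S̄)/(2i)`, using
`∫ S̄ e^{iξx} dμ = conj ∫ S e^{-iξx} dμ = 0`.) [folklore] -/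
theorem ae_eq_zero_of_forall_integral_mul_cexp_eq_zero {μ : Measure ℝ} [IsFiniteMeasure μ]
    {S : ℝ → ℂ} (hS : Integrable S μ)
    (h : ∀ ξ : ℝ, ∫ x, S x * cexp (ξ * x * I) ∂μ = 0) : S =ᵐ[μ] 0 := by
  have hker : ∀ ξ : ℝ, Continuous fun x : ℝ => cexp (ξ * x * I) := fun ξ => by fun_prop
  have hnorm : ∀ ξ x : ℝ, ‖cexp (ξ * x * I)‖ = 1 := fun ξ x => by
    rw [show (ξ : ℂ) * x * I = ((ξ * x : ℝ) : ℂ) * I by push_cast; ring]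
    exact norm_exp_ofReal_mul_I _
  have hint : ∀ {T : ℝ → ℂ}, Integrable T μ → ∀ ξ : ℝ,
      Integrable (fun x => T x * cexp (ξ * x * I)) μ := fun hT ξ =>
    hT.mul_bdd (hker ξ).aestronglyMeasurable (Eventually.of_forall fun x => (hnorm ξ x).le)
  have hSc : Integrable (fun x => conj (S x)) μ :=
    (LinearIsometryEquiv.integrable_comp_iff conjLIE).2 hS
  -- the conjugate density has vanishing Fourier transform too
  have hconj : ∀ ξ : ℝ, ∫ x, conj (S x) * cexp (ξ * x * I) ∂μ = 0 := fun ξ => by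
    have hx : ∀ x : ℝ, conj (S x) * cexp (ξ * x * I) =
        conj (S x * cexp ((((-ξ : ℝ)) : ℂ) * x * I)) := fun x => by
      rw [map_mul, ← exp_conj, map_mul, map_mul, conj_ofReal, conj_ofReal, conj_I]
      push_cast
      ring_nf
    simp_rw [hx]
    rw [integral_conj, h (-ξ), map_zero]
  have hre : ∀ ξ : ℝ, ∫ x, ((S x).re : ℂ) * cexp (ξ * x * I) ∂μ = 0 := fun ξ => by
    have hx : ∀ x : ℝ, ((S x).re : ℂ) * cexp (ξ * x * I) =
        (1 / 2 : ℂ) * (S x * cexp (ξ * x * I) + conj (S x) * cexp (ξ * x * I)) := fun x => by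
      rw [re_eq_add_conj]; ring
    simp_rw [hx]
    rw [integral_const_mul, integral_add (hint hS ξ) (hint hSc ξ), h ξ, hconj ξ]
    simp
  have him : ∀ ξ : ℝ, ∫ x, ((S x).im : ℂ) * cexp (ξ * x * I) ∂μ = 0 := fun ξ => by
    have hx : ∀ x : ℝ, ((S x).im : ℂ) * cexp (ξ * x * I) =
        (1 / (2 * I) : ℂ) * (S x * cexp (ξ * x * I) - conj (S x) * cexp (ξ * x * I)) := fun x => by
      rw [im_eq_sub_conj]; ring
    simp_rw [hx]
    rw [integral_const_mul, integral_sub (hint hS ξ) (hint hSc ξ), h ξ, hconj ξ]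
    simp
  have h1 := ae_eq_zero_of_forall_integral_ofReal_mul_cexp_eq_zero hS.re hre
  have h2 := ae_eq_zero_of_forall_integral_ofReal_mul_cexp_eq_zero hS.im him
  filter_upwards [h1, h2] with x hx1 hx2
  exact Complex.ext hx1 hx2

/-! ### The Laplace transform of a bounded density against a finite measure on `[0, κ)` -/

/-- **The Laplace transform `∫ e^{-lz} S(l) dμ(l)` of a bounded density against a finite measure
carried by `[0, κ)` is entire** (differentiation under the integral sign, via the tree's
`differentiableOn_integral_of_dominated_holomorphic` on every disc). [folklore] -/
theorem differentiable_laplace_measure {μ : Measure ℝ} [IsFiniteMeasure μ] {S : ℝ → ℂ}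
    (hS : AEStronglyMeasurable S μ) {M κ : ℝ} (hSM : ∀ᵐ l ∂μ, ‖S l‖ ≤ M)
    (hsupp : ∀ᵐ l ∂μ, l ∈ Ico 0 κ) :
    Differentiable ℂ fun z : ℂ => ∫ l, cexp (-(l : ℂ) * z) * S l ∂μ := by
  intro z₀
  set R : ℝ := ‖z₀‖ + 1 with hR
  have hmem : z₀ ∈ ball (0 : ℂ) R := by
    rw [mem_ball, dist_zero_right, hR]; exact lt_add_one _
  suffices h : DifferentiableOn ℂ (fun z : ℂ => ∫ l, cexp (-(l : ℂ) * z) * S l ∂μ)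
      (ball (0 : ℂ) R) from h.differentiableAt (isOpen_ball.mem_nhds hmem)
  refine Literature.Analysis.Fourier.differentiableOn_integral_of_dominated_holomorphic isOpen_ball
    (K := fun (z : ℂ) (l : ℝ) => cexp (-(l : ℂ) * z) * S l) (B := fun _ => Real.exp (κ * R) * M)
    (fun w _ => ?_) (Eventually.of_forall fun l => ?_) ?_ (integrable_const _)
  · exact (Continuous.aestronglyMeasurable (by fun_prop)).mul hS
  · exact ((differentiable_id.const_mul (-(l : ℂ))).cexp.mul_const (S l)).differentiableOn
  · filter_upwards [hSM, hsupp] with l hl hls w hw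
    rw [norm_mul, norm_cexp_neg_ofReal_mul]
    refine mul_le_mul (Real.exp_le_exp.2 ?_) hl (norm_nonneg _) (Real.exp_pos _).le
    rw [mem_ball, dist_zero_right] at hw
    have h1 : -w.re ≤ ‖w‖ := by
      have h := abs_re_le_norm w
      rw [abs_le] at h
      linarith [h.1]
    have h2 : l * -w.re ≤ l * ‖w‖ := mul_le_mul_of_nonneg_left h1 hls.1
    have h3 : l * ‖w‖ ≤ κ * R := mul_le_mul hls.2.le hw.le (norm_nonneg _) (hls.1.trans hls.2.le)
    linarith

/-- Growth of `E(z) = e^{κz} ∫ e^{-lz} S(l) dμ(l) = ∫ e^{(κ-l)z} S(l) dμ(l)` for a finite measure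
`μ` carried by `[0, κ)` and `‖S‖ ≤ M` `μ`-a.e.: `‖E(z)‖ ≤ e^{κ max(Re z, 0)} M μ(ℝ)`; in
particular `E` is bounded by `M μ(ℝ)` on the closed left half-plane and of exponential type `κ`.
[folklore] -/
theorem norm_cexp_mul_laplace_measure_le {μ : Measure ℝ} [IsFiniteMeasure μ] {S : ℝ → ℂ}
    {M κ : ℝ} (hSM : ∀ᵐ l ∂μ, ‖S l‖ ≤ M) (hsupp : ∀ᵐ l ∂μ, l ∈ Ico 0 κ) (z : ℂ) :
    ‖cexp (κ * z) * ∫ l, cexp (-(l : ℂ) * z) * S l ∂μ‖ ≤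
      Real.exp (κ * max z.re 0) * M * μ.real univ := by
  rw [← integral_const_mul]
  refine norm_integral_le_of_norm_le_const ?_
  filter_upwards [hSM, hsupp] with l hl hls
  rw [norm_mul, norm_mul, ← mul_assoc, Complex.norm_exp, norm_cexp_neg_ofReal_mul,
    ← Real.exp_add, re_ofReal_mul]
  refine mul_le_mul (Real.exp_le_exp.2 ?_) hl (norm_nonneg _) (Real.exp_pos _).le
  have h1 : z.re ≤ max z.re 0 := le_max_left _ _
  have h2 : 0 ≤ max z.re 0 := le_max_right _ _
  nlinarith [mul_le_mul_of_nonneg_left h1 (sub_pos.2 hls.2).le, mul_nonneg hls.1 h2]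

/-- The limit `E(-X) = ∫ e^{-(κ-l)X} S(l) dμ(l) → 0` as `X = n → +∞`, for a finite measure `μ`
carried by `[0, κ)` and `‖S‖ ≤ M` `μ`-a.e. (dominated convergence: the integrand tends to `0`
wherever `l < κ`). [folklore] -/
theorem tendsto_cexp_mul_laplace_measure_atTop {μ : Measure ℝ} [IsFiniteMeasure μ] {S : ℝ → ℂ}
    (hS : AEStronglyMeasurable S μ) {M κ : ℝ} (hSM : ∀ᵐ l ∂μ, ‖S l‖ ≤ M)
    (hsupp : ∀ᵐ l ∂μ, l ∈ Ico 0 κ) :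
    Tendsto (fun n : ℕ => cexp (κ * (((-(n : ℝ)) : ℝ) : ℂ)) *
      ∫ l, cexp (-(l : ℂ) * (((-(n : ℝ)) : ℝ) : ℂ)) * S l ∂μ) atTop (𝓝 0) := by
  set F : ℕ → ℝ → ℂ := fun (n : ℕ) (l : ℝ) =>
    cexp (κ * (((-(n : ℝ)) : ℝ) : ℂ)) * (cexp (-(l : ℂ) * (((-(n : ℝ)) : ℝ) : ℂ)) * S l) with hF
  have hFnorm : ∀ (n : ℕ) (l : ℝ), ‖F n l‖ = Real.exp (-((κ - l) * n)) * ‖S l‖ := by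
    intro n l
    simp only [hF]
    rw [norm_mul, norm_mul, ← mul_assoc, Complex.norm_exp, norm_cexp_neg_ofReal_mul,
      ← Real.exp_add, re_ofReal_mul, ofReal_re]
    congr 2
    ring
  have key : Tendsto (fun n : ℕ => ∫ l, F n l ∂μ) atTop (𝓝 (∫ _ : ℝ, (0 : ℂ) ∂μ)) := by
    refine tendsto_integral_of_dominated_convergence (fun _ => M) (fun n => ?_)
      (integrable_const M) (fun n => ?_) ?_
    · simp only [hF]
      exact ((Continuous.aestronglyMeasurable (by fun_prop)).mul hS).const_mul _
    · filter_upwards [hSM, hsupp] with l hl hls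
      rw [hFnorm]
      refine (mul_le_of_le_one_left (norm_nonneg _) (Real.exp_le_one_iff.2 ?_)).trans hl
      have : 0 ≤ (κ - l) * n := mul_nonneg (sub_pos.2 hls.2).le n.cast_nonneg
      linarith
    · filter_upwards [hsupp] with l hls
      rw [tendsto_zero_iff_norm_tendsto_zero]
      have h : (fun n : ℕ => ‖F n l‖) = fun n : ℕ => Real.exp (-((κ - l) * n)) * ‖S l‖ :=
        funext fun n => hFnorm n l
      rw [h]
      simpa using (Real.tendsto_exp_neg_atTop_nhds_zero.comp
        ((tendsto_natCast_atTop_atTop (R := ℝ)).const_mul_atTop (sub_pos.2 hls.2))).mul_const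
          ‖S l‖
  rw [integral_zero] at key
  exact key.congr fun n => integral_const_mul _ _

/-! ### The theorem -/

/-- **Exponential decay of the Laplace transform of a measure forces vanishing of the density
near `0` (Pólya's indicator theorem for Laplace–Stieltjes transforms on `[0, ∞)`, real-axis
form).** Let `m` be a finite positive measure on `ℝ` with `m (-∞, 0) = 0`, let `S` be continuous
with `‖S‖ ≤ M`, let `κ > 0`, and suppose `‖∫ e^{-lX} S(l) dm(l)‖ ≤ C e^{-κX}` for all real
`X ≥ X₀`. Then `S = 0` `m`-a.e. on `(-∞, κ)`. (Boas, *Entire Functions*, §5.3–§5.4: the conjugate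
indicator diagram of the Borel–Laplace transform of a compactly supported measure is the convex
hull of its support; the present statement is the case of the direction `θ = π`, proved via
Phragmén–Lindelöf in the right half-plane, Liouville, and injectivity of the characteristic
function of finite measures.) [cite: Boas1954, §5.4] -/
theorem ae_eq_zero_of_laplace_exp_decay_measure {m : MeasureTheory.Measure ℝ}
    [MeasureTheory.IsFiniteMeasure m]
    (hsupp : m (Set.Iio 0) = 0) {S : ℝ → ℂ} (hS : Continuous S) {M : ℝ} (hSM : ∀ l : ℝ, ‖S l‖ ≤ M)
    {κ C X₀ : ℝ} (hκ : 0 < κ)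
    (hdecay : ∀ X : ℝ, X₀ ≤ X →
      ‖∫ l, Complex.exp (-(l : ℂ) * X) * S l ∂m‖ ≤ C * Real.exp (-κ * X)) :
    ∀ᵐ l ∂m, l < κ → S l = 0 := by
  -- `m` is carried by `[0, ∞)`
  have h0 : ∀ᵐ l ∂m, 0 ≤ l := by
    filter_upwards [measure_eq_zero_iff_ae_notMem.1 hsupp] with l hl using not_lt.1 hl
  have hM0 : 0 ≤ M := (norm_nonneg _).trans (hSM 0)
  have hSm : ∀ μ : Measure ℝ, AEStronglyMeasurable S μ := fun μ => hS.aestronglyMeasurable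
  -- the piece `m₁ = m|_{(-∞, κ)}`, its Laplace transform `G₁` and `E = e^{κ z} G₁`
  set m₁ : Measure ℝ := m.restrict (Iio κ) with hm₁def
  have hsupp₁ : ∀ᵐ l ∂m₁, l ∈ Ico 0 κ := by
    filter_upwards [ae_restrict_mem (μ := m) (measurableSet_Iio (a := κ)),
      ae_restrict_of_ae (s := Iio κ) h0] with l h1 h2
    exact ⟨h2, h1⟩
  have hSM₁ : ∀ᵐ l ∂m₁, ‖S l‖ ≤ M := Eventually.of_forall hSM
  set G₁ : ℂ → ℂ := fun z => ∫ l, cexp (-(l : ℂ) * z) * S l ∂m₁ with hG₁def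
  set E : ℂ → ℂ := fun z => cexp (κ * z) * G₁ z with hEdef
  set L : ℝ := M * m.real univ with hLdef
  set L₁ : ℝ := M * m₁.real univ with hL₁def
  have hL₁0 : 0 ≤ L₁ := mul_nonneg hM0 measureReal_nonneg
  -- splitting off the tail `[κ, ∞)`: for real `X ≥ 0`
  have htail : ∀ X : ℝ, 0 ≤ X →
      ‖G₁ X‖ ≤ ‖∫ l, cexp (-(l : ℂ) * X) * S l ∂m‖ + Real.exp (-κ * X) * L := by
    intro X hX
    have hint : Integrable (fun l : ℝ => cexp (-(l : ℂ) * X) * S l) m := by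
      refine Integrable.of_bound ((Continuous.aestronglyMeasurable (by fun_prop)).mul (hSm m)) M ?_
      filter_upwards [h0] with l hl
      rw [norm_mul, norm_cexp_neg_ofReal_mul, ofReal_re]
      refine (mul_le_of_le_one_left (norm_nonneg _) (Real.exp_le_one_iff.2 ?_)).trans (hSM l)
      nlinarith
    have hsplit := integral_add_compl (measurableSet_Iio (a := κ)) hint
    have hm₂ : (m.restrict (Iio κ)ᶜ).real univ ≤ m.real univ := by
      simp only [measureReal_def]
      exact ENNReal.toReal_mono (measure_ne_top _ _) (Measure.restrict_apply_le _ _)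
    have h2 : ‖∫ l in (Iio κ)ᶜ, cexp (-(l : ℂ) * X) * S l ∂m‖ ≤ Real.exp (-κ * X) * L := by
      have hb : ∀ᵐ (l : ℝ) ∂m.restrict (Iio κ)ᶜ,
          ‖cexp (-(l : ℂ) * X) * S l‖ ≤ Real.exp (-κ * X) * M := by
        filter_upwards [ae_restrict_mem (μ := m) (measurableSet_Iio (a := κ)).compl] with l hl
        rw [mem_compl_iff, mem_Iio, not_lt] at hl
        rw [norm_mul, norm_cexp_neg_ofReal_mul, ofReal_re]
        refine mul_le_mul (Real.exp_le_exp.2 ?_) (hSM l) (norm_nonneg _) (Real.exp_pos _).le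
        nlinarith
      calc ‖∫ l in (Iio κ)ᶜ, cexp (-(l : ℂ) * X) * S l ∂m‖
          ≤ Real.exp (-κ * X) * M * (m.restrict (Iio κ)ᶜ).real univ :=
            norm_integral_le_of_norm_le_const hb
        _ ≤ Real.exp (-κ * X) * M * m.real univ := by gcongr
        _ = Real.exp (-κ * X) * L := by rw [hLdef, mul_assoc]
    calc ‖G₁ X‖ = ‖(∫ l, cexp (-(l : ℂ) * X) * S l ∂m) -
          ∫ l in (Iio κ)ᶜ, cexp (-(l : ℂ) * X) * S l ∂m‖ := by
          rw [← hsplit, add_sub_cancel_right]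
      _ ≤ ‖∫ l, cexp (-(l : ℂ) * X) * S l ∂m‖ +
          ‖∫ l in (Iio κ)ᶜ, cexp (-(l : ℂ) * X) * S l ∂m‖ := norm_sub_le _ _
      _ ≤ ‖∫ l, cexp (-(l : ℂ) * X) * S l ∂m‖ + Real.exp (-κ * X) * L := by gcongr
  -- `E` is entire, of exponential type `κ`, bounded on the closed left half-plane
  have hEd : Differentiable ℂ E :=
    ((differentiable_id.const_mul (κ : ℂ)).cexp).mul
      (differentiable_laplace_measure (hSm m₁) hSM₁ hsupp₁)
  have hEbound : ∀ z, ‖E z‖ ≤ Real.exp (κ * max z.re 0) * L₁ := fun z => by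
    have h := norm_cexp_mul_laplace_measure_le hSM₁ hsupp₁ z
    rwa [mul_assoc] at h
  have hAB : ∀ z, ‖E z‖ ≤ L₁ * Real.exp (κ * ‖z‖) := fun z => by
    refine (hEbound z).trans ?_
    rw [mul_comm]
    gcongr
    exact max_le (re_le_norm z) (norm_nonneg z)
  have hleft : ∀ z : ℂ, z.re ≤ 0 → ‖E z‖ ≤ L₁ := fun z hz => by
    have h := hEbound z
    rwa [max_eq_right hz, mul_zero, Real.exp_zero, one_mul] at h
  -- bounded on the positive real axis (the decay hypothesis enters here)
  set X₁ : ℝ := max X₀ 0 with hX₁def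
  set C₁ : ℝ := max (C + L) (Real.exp (κ * X₁) * L₁) with hC₁def
  have hreal : ∀ x : ℝ, 0 ≤ x → ‖E x‖ ≤ C₁ * Real.exp (0 * x) := fun x hx => by
    rw [zero_mul, Real.exp_zero, mul_one]
    rcases le_or_gt X₁ x with h | h
    · have hX₀ : X₀ ≤ x := (le_max_left _ _).trans h
      have h1 := htail x hx
      have h2 := hdecay x hX₀
      have hx' : Real.exp (κ * x) * Real.exp (-κ * x) = 1 := by
        rw [← Real.exp_add, show κ * x + -κ * x = 0 by ring, Real.exp_zero]
      calc ‖E x‖ = Real.exp (κ * x) * ‖G₁ x‖ := by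
            simp only [hEdef]
            rw [norm_mul, Complex.norm_exp, re_ofReal_mul, ofReal_re]
        _ ≤ Real.exp (κ * x) * (C * Real.exp (-κ * x) + Real.exp (-κ * x) * L) := by
            gcongr
            exact h1.trans (add_le_add h2 le_rfl)
        _ = C * (Real.exp (κ * x) * Real.exp (-κ * x)) +
              Real.exp (κ * x) * Real.exp (-κ * x) * L := by ring
        _ = C + L := by rw [hx', mul_one, one_mul]
        _ ≤ C₁ := le_max_left _ _
    · have h1 := hEbound x
      rw [ofReal_re, max_eq_left hx] at h1
      calc ‖E x‖ ≤ Real.exp (κ * x) * L₁ := h1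
        _ ≤ Real.exp (κ * X₁) * L₁ := by gcongr
        _ ≤ C₁ := le_max_right _ _
  -- bounded by `L₁` on the imaginary axis
  have himag : ∀ y : ℝ, ‖E (y * I)‖ ≤ L₁ * Real.exp (0 * |y|) := fun y => by
    rw [zero_mul, Real.exp_zero, mul_one]
    exact hleft _ (by simp)
  -- Phragmén–Lindelöf in the right half-plane, then Liouville
  have hright : ∀ z : ℂ, 0 ≤ z.re → ‖E z‖ ≤ max C₁ L₁ := fun z hz => by
    have h := norm_le_exp_of_re_nonneg hEd hAB hreal himag hz
    rwa [zero_mul, zero_mul, add_zero, Real.exp_zero, mul_one] at h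
  have hbdd : IsBounded (range E) := by
    rw [isBounded_iff_forall_norm_le]
    refine ⟨max C₁ L₁, ?_⟩
    rintro _ ⟨z, rfl⟩
    rcases le_total 0 z.re with hz | hz
    · exact hright z hz
    · exact (hleft z hz).trans (le_max_right _ _)
  have hconst : ∀ z w, E z = E w := fun z w => hEd.apply_eq_apply_of_bounded hbdd z w
  -- the constant is `0`: `E(-n) → 0`
  have hlim : Tendsto (fun n : ℕ => E (((-(n : ℝ)) : ℝ) : ℂ)) atTop (𝓝 0) :=
    tendsto_cexp_mul_laplace_measure_atTop (hSm m₁) hSM₁ hsupp₁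
  have hE0 : E 0 = 0 :=
    tendsto_const_nhds_iff.1 (hlim.congr fun n => hconst _ _)
  have hG₁ : ∀ z, G₁ z = 0 := fun z => by
    have h : E z = 0 := (hconst z 0).trans hE0
    exact (mul_eq_zero.1 h).resolve_left (Complex.exp_ne_zero _)
  -- hence the Fourier transform of `S dm₁` vanishes and `S = 0` `m₁`-a.e.
  have hF : ∀ ξ : ℝ, ∫ l, S l * cexp (ξ * l * I) ∂m₁ = 0 := fun ξ => by
    have h := hG₁ (-(ξ : ℂ) * I)
    simp only [hG₁def] at h
    rw [← h]
    refine integral_congr_ae (Eventually.of_forall fun l => ?_)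
    simp only
    rw [mul_comm (S l)]
    congr 2
    ring
  have hint₁ : Integrable S m₁ := Integrable.of_bound (hSm m₁) M hSM₁
  have hae : S =ᵐ[m₁] 0 := ae_eq_zero_of_forall_integral_mul_cexp_eq_zero hint₁ hF
  have hae' : ∀ᵐ l ∂m, l ∈ Iio κ → S l = (0 : ℝ → ℂ) l :=
    (ae_restrict_iff' measurableSet_Iio).1 hae
  filter_upwards [hae'] with l hl hlκ
  exact hl hlκ

end Literature.Analysis.Complex
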